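import Literature.RingTheory.MvPolynomial.VanishingOnSubspace
import HarnessLib

/-!
# The chart forms of a line: polynomials vanishing on `span(u, v)` lie in `(x_c - u_c x_{i₀} - v_c x_{j₀})`

For vectors `u, v ∈ K⁹` in CHART NORMAL FORM (`u_{i₀} = 1`, `u_{j₀} = 0`, `v_{i₀} = 0`, `v_{j₀} = 1`,
the shape produced by the Plücker pivot of `Motives/HirschowitzIyerCoveringValuative` §3 and
`Motives/HirschowitzIyerVerticalFlag`) the plane `span(u, v) ⊆ K⁹` is cut out by the seven linear
**chart forms** `x_c - u_c x_{i₀} - v_c x_{j₀}`, `c ∉ {i₀, j₀}` — these are the coordinate forms, along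
the standard vectors `e_c`, of the basis `(u, v, (e_c)_{c ∉ {i₀, j₀}})` of `K⁹` — and therefore, by
`Literature.RingTheory.MvPolynomial.mem_ideal_span_coordForm_of_forall_eval_eq_zero`, **every
polynomial vanishing on `span(u, v)` lies in the ideal they generate** (`K` infinite). This is the
universality of the line forms used to recognise the vertical fibres of Hirschowitz–Iyer's ruled
surface (limits of strong lines) inside a given strong line.

* `chartForm u v i₀ j₀ c`, `eval_chartForm`, `isHomogeneous_chartForm`, `eval_chartForm_of_mem_span`;
* `chartBasis` — the basis `(u, v, e_c)` and its coordinates (`chartBasis_repr_apply`);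
* `mem_ideal_span_chartForm_of_forall_eval_eq_zero`.

## References

* R. Hartshorne, *Algebraic Geometry* (1977), I Ex. 2.11 (linear varieties). [Hartshorne1977]
-/

noncomputable section

open MvPolynomial

namespace Literature.AlgebraicGeometry.Motives

namespace StrongLineCover

variable {K : Type*} [Field K]

/-- **The chart form** `x_c - u_c x_{i₀} - v_c x_{j₀}`. [folklore] -/
def chartForm (u v : Fin (8 + 1) → K) (i₀ j₀ c : Fin (8 + 1)) : MvPolynomial (Fin (8 + 1)) K :=
  X c - C (u c) * X i₀ - C (v c) * X j₀

/-- Evaluation of a chart form. [folklore] -/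
@[simp]
theorem eval_chartForm (u v : Fin (8 + 1) → K) (i₀ j₀ c : Fin (8 + 1)) (q : Fin (8 + 1) → K) :
    MvPolynomial.eval q (chartForm u v i₀ j₀ c) = q c - u c * q i₀ - v c * q j₀ := by
  simp [chartForm]

/-- Chart forms are linear forms. [folklore] -/
theorem isHomogeneous_chartForm (u v : Fin (8 + 1) → K) (i₀ j₀ c : Fin (8 + 1)) :
    (chartForm u v i₀ j₀ c).IsHomogeneous 1 := by
  unfold chartForm
  refine ((isHomogeneous_X K c).sub ?_).sub ?_
  · exact isHomogeneous_C_mul_X _ _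
  · exact isHomogeneous_C_mul_X _ _

/-- Chart forms under a ring map. [folklore] -/
theorem map_chartForm {S : Type*} [CommRing S] (f : K →+* S) (u v : Fin (8 + 1) → K) (i₀ j₀ c : Fin (8 + 1)) :
    MvPolynomial.map f (chartForm u v i₀ j₀ c) = X c - C (f (u c)) * X i₀ - C (f (v c)) * X j₀ := by
  simp [chartForm, map_X, map_C]

section NormalForm

variable {u v : Fin (8 + 1) → K} {i₀ j₀ : Fin (8 + 1)}
  (hui : u i₀ = 1) (huj : u j₀ = 0) (hvi : v i₀ = 0) (hvj : v j₀ = 1)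
include hui huj hvi hvj

omit hvi hvj in
/-- Bookkeeping. [folklore] -/
theorem i₀_ne_j₀ : i₀ ≠ j₀ := fun h => by rw [h, huj] at hui; exact zero_ne_one hui

/-- In chart normal form the chart forms vanish on `u` and `v`, hence on `span(u, v)`. [folklore] -/
theorem eval_chartForm_of_mem_span (c : Fin (8 + 1)) {q : Fin (8 + 1) → K}
    (hq : q ∈ Submodule.span K (Set.range ![u, v])) : MvPolynomial.eval q (chartForm u v i₀ j₀ c) = 0 := by
  rw [Matrix.range_cons_cons_empty, Submodule.mem_span_pair] at hq
  obtain ⟨a, b, rfl⟩ := hq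
  simp [hui, huj, hvi, hvj]
  ring

/-- The coordinate map of the basis `(u, v, e_c)`: `x ↦ (x_{i₀}, x_{j₀}, x_c - u_c x_{i₀} - v_c x_{j₀})`.
[folklore] -/
def chartCoords : (Fin (8 + 1) → K) ≃ₗ[K] (Fin (8 + 1) → K) where
  toFun x i := if i = i₀ then x i₀ else if i = j₀ then x j₀ else x i - u i * x i₀ - v i * x j₀
  invFun d i := d i₀ * u i + d j₀ * v i + (if i = i₀ ∨ i = j₀ then 0 else d i)
  map_add' x y := by
    funext i
    simp only [Pi.add_apply]
    split_ifs <;> ring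
  map_smul' a x := by
    funext i
    simp only [Pi.smul_apply, smul_eq_mul, RingHom.id_apply]
    split_ifs <;> ring
  left_inv x := by
    have hij := i₀_ne_j₀ hui huj
    funext i
    dsimp only
    simp only [if_neg (Ne.symm hij), if_true]
    by_cases h1 : i = i₀
    · subst h1; simp only [hui, hvi, true_or, if_true]; ring
    · by_cases h2 : i = j₀
      · subst h2; simp only [huj, hvj, or_true, if_true]; ring
      · rw [if_neg (not_or.mpr ⟨h1, h2⟩), if_neg h1, if_neg h2]; ring
  right_inv d := by
    have hij := i₀_ne_j₀ hui huj
    funext i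
    dsimp only
    by_cases h1 : i = i₀
    · subst h1
      rw [if_pos rfl, if_pos (Or.inl rfl), hui, hvi]; ring
    · by_cases h2 : i = j₀
      · subst h2
        rw [if_neg h1, if_pos rfl, if_pos (Or.inr rfl), huj, hvj]; ring
      · rw [if_neg h1, if_neg h2, if_neg (not_or.mpr ⟨h1, h2⟩), if_pos (Or.inl rfl), if_pos (Or.inr rfl),
          hui, hvi, huj, hvj]
        ring

/-- **The chart basis** `(u, v, (e_c)_{c ∉ {i₀, j₀}})` of `K⁹`, indexed by `Fin 9` (`i₀ ↦ u`,
`j₀ ↦ v`, `c ↦ e_c`). [folklore] -/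
def chartBasis : Module.Basis (Fin (8 + 1)) K (Fin (8 + 1) → K) :=
  Module.Basis.ofEquivFun (chartCoords hui huj hvi hvj)

/-- Bookkeeping. [folklore] -/
theorem chartBasis_repr_apply (x : Fin (8 + 1) → K) (i : Fin (8 + 1)) :
    (chartBasis hui huj hvi hvj).repr x i =
      (if i = i₀ then x i₀ else if i = j₀ then x j₀ else x i - u i * x i₀ - v i * x j₀) :=
  Module.Basis.ofEquivFun_repr_apply _ _ _

/-- Bookkeeping. [folklore] -/
theorem chartBasis_apply (i : Fin (8 + 1)) (m : Fin (8 + 1)) :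
    chartBasis hui huj hvi hvj i m = (Pi.single i (1 : K) : Fin (8 + 1) → K) i₀ * u m +
      (Pi.single i (1 : K) : Fin (8 + 1) → K) j₀ * v m +
        (if m = i₀ ∨ m = j₀ then 0 else (Pi.single i (1 : K) : Fin (8 + 1) → K) m) := by
  classical
  rw [chartBasis, Module.Basis.coe_ofEquivFun]
  rfl

/-- Bookkeeping. [folklore] -/
theorem chartBasis_i₀ : chartBasis hui huj hvi hvj i₀ = u := by
  have hij := i₀_ne_j₀ hui huj
  funext m
  rw [chartBasis_apply, Pi.single_eq_same, Pi.single_eq_of_ne (Ne.symm hij), one_mul, zero_mul, add_zero]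
  by_cases h1 : m = i₀
  · subst h1; rw [if_pos (Or.inl rfl), add_zero]
  · by_cases h2 : m = j₀
    · subst h2; rw [if_pos (Or.inr rfl), add_zero]
    · rw [if_neg (not_or.mpr ⟨h1, h2⟩), Pi.single_eq_of_ne h1, add_zero]

/-- Bookkeeping. [folklore] -/
theorem chartBasis_j₀ : chartBasis hui huj hvi hvj j₀ = v := by
  have hij := i₀_ne_j₀ hui huj
  funext m
  rw [chartBasis_apply, Pi.single_eq_same, Pi.single_eq_of_ne hij, one_mul, zero_mul, zero_add]
  by_cases h1 : m = i₀
  · subst h1; rw [if_pos (Or.inl rfl), add_zero]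
  · by_cases h2 : m = j₀
    · subst h2; rw [if_pos (Or.inr rfl), add_zero]
    · rw [if_neg (not_or.mpr ⟨h1, h2⟩), Pi.single_eq_of_ne h2, add_zero]

/-- **The coordinate forms of the chart basis along the `e_c` are the chart forms.** [folklore] -/
theorem coordForm_chartBasis {c : Fin (8 + 1)} (hc : c ≠ i₀ ∧ c ≠ j₀) :
    (∑ m : Fin (8 + 1), C ((chartBasis hui huj hvi hvj).repr (Pi.single m 1) c) * X m :
      MvPolynomial (Fin (8 + 1)) K) = chartForm u v i₀ j₀ c := by
  have hij := i₀_ne_j₀ hui huj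
  have hcoef : ∀ m : Fin (8 + 1), (chartBasis hui huj hvi hvj).repr (Pi.single m 1) c =
      (Pi.single c (1 : K) : Fin (8 + 1) → K) m - u c * (Pi.single i₀ (1 : K) : Fin (8 + 1) → K) m -
        v c * (Pi.single j₀ (1 : K) : Fin (8 + 1) → K) m := by
    intro m
    rw [chartBasis_repr_apply, if_neg hc.1, if_neg hc.2]
    simp only [Pi.single_apply, eq_comm (a := i₀) (b := m), eq_comm (a := j₀) (b := m), eq_comm (a := c) (b := m)]
  simp_rw [hcoef]
  simp only [map_sub, map_mul, sub_mul, Finset.sum_sub_distrib]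
  have hs : ∀ (a : K) (k : Fin (8 + 1)), (∑ m : Fin (8 + 1), C a * C ((Pi.single k (1 : K) : Fin (8 + 1) → K) m) * X m :
      MvPolynomial (Fin (8 + 1)) K) = C a * X k := by
    intro a k
    rw [Finset.sum_eq_single k]
    · rw [Pi.single_eq_same, map_one, mul_one]
    · intro m _ hm
      rw [Pi.single_eq_of_ne hm, map_zero, mul_zero, zero_mul]
    · intro h; exact absurd (Finset.mem_univ k) h
  have hs1 : (∑ m : Fin (8 + 1), C ((Pi.single c (1 : K) : Fin (8 + 1) → K) m) * X m :
      MvPolynomial (Fin (8 + 1)) K) = X c := by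
    have h := hs 1 c
    simpa using h
  rw [hs1, hs, hs, chartForm]

/-- **Universality of the chart forms**: a polynomial vanishing on `span(u, v)` lies in the ideal
`(x_c - u_c x_{i₀} - v_c x_{j₀} : c ∉ {i₀, j₀})` (`K` infinite). [cite: Hartshorne1977, I Ex. 2.11] -/
theorem mem_ideal_span_chartForm_of_forall_eval_eq_zero [Infinite K] (G : MvPolynomial (Fin (8 + 1)) K)
    (hG : ∀ q ∈ Submodule.span K (Set.range ![u, v]), MvPolynomial.eval q G = 0) :
    G ∈ Ideal.span ((fun c => chartForm u v i₀ j₀ c) '' {c | c ≠ i₀ ∧ c ≠ j₀}) := by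
  classical
  set T : Set (Fin (8 + 1)) := {c | c ≠ i₀ ∧ c ≠ j₀} with hT
  have h := Literature.RingTheory.MvPolynomial.mem_ideal_span_coordForm_of_forall_eval_eq_zero
    (chartBasis hui huj hvi hvj) T G (fun coef hcoef => hG _ ?_)
  · have himg : (fun i : Fin (8 + 1) => (∑ m : Fin (8 + 1), C ((chartBasis hui huj hvi hvj).repr (Pi.single m 1) i) * X m :
        MvPolynomial (Fin (8 + 1)) K)) '' T = (fun c => chartForm u v i₀ j₀ c) '' T := by
      refine Set.image_congr fun c hc => ?_
      exact coordForm_chartBasis hui huj hvi hvj hc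
    rwa [himg] at h
  · -- `Σ_{i ∉ T} coef_i b_i = coef_{i₀} u + coef_{j₀} v`
    have hij := i₀_ne_j₀ hui huj
    rw [Matrix.range_cons_cons_empty, Submodule.mem_span_pair]
    refine ⟨coef i₀, coef j₀, ?_⟩
    funext m
    simp only [Pi.add_apply, Pi.smul_apply, smul_eq_mul]
    have hsum : ∑ i, coef i * chartBasis hui huj hvi hvj i m =
        coef i₀ * chartBasis hui huj hvi hvj i₀ m + coef j₀ * chartBasis hui huj hvi hvj j₀ m := by
      rw [← Finset.sum_subset (Finset.subset_univ {i₀, j₀})]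
      · rw [Finset.sum_pair hij]
      · intro i _ hi
        have hiT : i ∈ T := by
          simp only [Finset.mem_insert, Finset.mem_singleton, not_or] at hi
          exact hi
        rw [hcoef i hiT, zero_mul]
    rw [hsum, chartBasis_i₀, chartBasis_j₀]

end NormalForm

end StrongLineCover

end Literature.AlgebraicGeometry.Motives

end
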